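import Summits.CriticalPhenomena.CardyFormulaZ2.Theorems.CardyBoundaryCoulombGasBoundaryDefectGaussianRStubTransportPathsPart16

/-!
# Stub `stub_transportPaths` of line `rainbow-monomials-in-excursion-kernels` — Part 17:
# the lattice corner of the approximation and the jump across it
# (crux `CardyBoundaryCoulombGas.BoundaryDefectGaussianR`, stmt-CriticalPhenomena-14132)

At a corner `P` of the polygon where the incoming edge has frame exponent `f` and the outgoing
edge `e`, with the turning rule `e + m ≡ f + 2 (mod 4)`, `m ∈ {1, 3}` (convex / reflex), let
`F, E : Fin 4` be the exponents, `Yp = ⌈im (P (-i)^f) / δ⌉`, `Y = ⌈im (P (-i)^e) / δ⌉` the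
thresholds of the two rails and `C = Yp • dir (F+1) + Y • dir (E+1)` the LATTICE CORNER.
`tp_corner_jump`: if near `P` the closure of the domain is the closed sector of `m` quadrants
(corner chart of Part 8) at a radius `≥ δ (2 J₀ + 8)`, then

* in the frame of the out-direction `F + 3` of the incoming rail, membership near `C` is the
  convex rule `t ≤ 0 ∧ s ≤ 0` (`m = 1`) or the reflex rule `t ≤ 0 ∨ 0 ≤ s` (`m = 3`), so the walk
  of Part 9 links the take-off dart `(C - J₀ • dir F, F + 3)` to the landing dart
  `(C + J₀ • dir E, E + 3)`: `(dsucc V)^[g] _ = _`;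
* the jump has lattice length `√2 J₀`;
* the corner rounds by less than one mesh: `|δ ⟨C, dir E⟩ - re (P (-i)^e)| < δ` and
  `|δ ⟨C, dir F⟩ - re (P (-i)^f)| < δ` (the along-coordinates consumed by `tp_rail_point`).
All [folklore].
-/

noncomputable section

open Set Filter Metric Topology
open Literature.Probability.LatticeModels Literature.Probability.LatticeModels.CollarLegModel
open Summit.CriticalPhenomena.CardyFormulaZ2.Cruxes.RectilinearCardy.ExcursionKernelCovariance

namespace Summit.CriticalPhenomena.CardyFormulaZ2.Cruxes.BoundaryDefectGaussianR.RainbowMonomialsInExcursionKernels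

/-! ### Exponent bookkeeping -/

/-- `(-i)^n` only depends on `n mod 4`. [folklore] -/
theorem tp_negI_pow_mod (n : ℕ) : (-Complex.I) ^ n = (-Complex.I) ^ (n % 4) := by
  conv_lhs => rw [← Nat.div_add_mod n 4]
  rw [pow_add, pow_mul, neg_pow Complex.I 4, Complex.I_pow_four]
  norm_num

/-- One more clockwise quarter turn of the frame: `re (u (-i)^(f+1)) = im (u (-i)^f)` and
`im (u (-i)^(f+1)) = - re (u (-i)^f)`. [folklore] -/
theorem tp_frame_succ (u : ℂ) (f : ℕ) :
    (u * (-Complex.I) ^ (f + 1)).re = (u * (-Complex.I) ^ f).im ∧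
    (u * (-Complex.I) ^ (f + 1)).im = -(u * (-Complex.I) ^ f).re := by
  rw [pow_succ, ← mul_assoc]
  exact mul_neg_I_re_im _

/-- Three more quarter turns: `re (u (-i)^(f+3)) = - im (u (-i)^f)` and
`im (u (-i)^(f+3)) = re (u (-i)^f)`. [folklore] -/
theorem tp_frame_add_three (u : ℂ) (f : ℕ) :
    (u * (-Complex.I) ^ (f + 3)).re = -(u * (-Complex.I) ^ f).im ∧
    (u * (-Complex.I) ^ (f + 3)).im = (u * (-Complex.I) ^ f).re := by
  have h3 : (-Complex.I) ^ 3 = Complex.I := by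
    rw [neg_pow, Complex.I_pow_three]; norm_num
  rw [pow_add, ← mul_assoc, h3]
  constructor <;> simp

/-- Casting the turning rule to `Fin 4`. [folklore] -/
theorem tp_fin_of_mod {e f j : ℕ} (h : e % 4 = (f + j) % 4) :
    (Fin.ofNat 4 e : Fin 4) = Fin.ofNat 4 f + Fin.ofNat 4 j := by
  apply Fin.ext
  rw [Fin.val_add, Fin.val_ofNat, Fin.val_ofNat, Fin.val_ofNat]
  omega

/-! ### The jump across a lattice corner -/

/-- **The lattice corner and the jump across it.** See the module docstring. [folklore] -/
theorem tp_corner_jump {S : Set ℂ} {δ : ℝ} (hδ : 0 < δ) {V : Finset (ℤ × ℤ)}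
    (hV : ∀ v : ℤ × ℤ, v ∈ V ↔
      ((v.1 : ℂ) * ((δ : ℝ) : ℂ) + (v.2 : ℂ) * ((δ : ℝ) : ℂ) * Complex.I) ∈ S)
    {P : ℂ} {e f m : ℕ} (he : e < 4) (hm : m = 1 ∨ m = 3)
    (hrel : (e + m) % 4 = (f + 2) % 4) {rC : ℝ} (J₀ : ℕ) (hJ₀ : 1 ≤ J₀)
    (hrad : δ * (2 * J₀ + 8) ≤ rC)
    (hclos : ∀ w, dist w P < rC → (w ∈ S ↔ ((m = 1 → 0 ≤ ((w - P) * (-Complex.I) ^ e).re ∧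
      0 ≤ ((w - P) * (-Complex.I) ^ e).im) ∧ (m = 2 → 0 ≤ ((w - P) * (-Complex.I) ^ e).im) ∧
      (m = 3 → 0 ≤ ((w - P) * (-Complex.I) ^ e).im ∨ ((w - P) * (-Complex.I) ^ e).re ≤ 0)))) :
    (∃ g : ℕ, (dsucc V)^[g]
        (⌈(P * (-Complex.I) ^ f).im / δ⌉ • dir (Fin.ofNat 4 f + 1) +
            ⌈(P * (-Complex.I) ^ e).im / δ⌉ • dir (Fin.ofNat 4 e + 1) - (J₀ : ℤ) • dir (Fin.ofNat 4 f),
          Fin.ofNat 4 f + 3) =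
        (⌈(P * (-Complex.I) ^ f).im / δ⌉ • dir (Fin.ofNat 4 f + 1) +
            ⌈(P * (-Complex.I) ^ e).im / δ⌉ • dir (Fin.ofNat 4 e + 1) + (J₀ : ℤ) • dir (Fin.ofNat 4 e),
          Fin.ofNat 4 e + 3)) ∧
    (((⌈(P * (-Complex.I) ^ f).im / δ⌉ • dir (Fin.ofNat 4 f + 1) +
            ⌈(P * (-Complex.I) ^ e).im / δ⌉ • dir (Fin.ofNat 4 e + 1) + (J₀ : ℤ) • dir (Fin.ofNat 4 e)).1 -
        (⌈(P * (-Complex.I) ^ f).im / δ⌉ • dir (Fin.ofNat 4 f + 1) +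
            ⌈(P * (-Complex.I) ^ e).im / δ⌉ • dir (Fin.ofNat 4 e + 1) - (J₀ : ℤ) • dir (Fin.ofNat 4 f)).1) ^ 2 +
      ((⌈(P * (-Complex.I) ^ f).im / δ⌉ • dir (Fin.ofNat 4 f + 1) +
            ⌈(P * (-Complex.I) ^ e).im / δ⌉ • dir (Fin.ofNat 4 e + 1) + (J₀ : ℤ) • dir (Fin.ofNat 4 e)).2 -
        (⌈(P * (-Complex.I) ^ f).im / δ⌉ • dir (Fin.ofNat 4 f + 1) +
            ⌈(P * (-Complex.I) ^ e).im / δ⌉ • dir (Fin.ofNat 4 e + 1) - (J₀ : ℤ) • dir (Fin.ofNat 4 f)).2) ^ 2 =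
      2 * (J₀ : ℤ) ^ 2) ∧
    |δ * ((⌈(P * (-Complex.I) ^ f).im / δ⌉ • dir (Fin.ofNat 4 f + 1) +
            ⌈(P * (-Complex.I) ^ e).im / δ⌉ • dir (Fin.ofNat 4 e + 1)).1 * (dir (Fin.ofNat 4 e)).1 +
          (⌈(P * (-Complex.I) ^ f).im / δ⌉ • dir (Fin.ofNat 4 f + 1) +
            ⌈(P * (-Complex.I) ^ e).im / δ⌉ • dir (Fin.ofNat 4 e + 1)).2 * (dir (Fin.ofNat 4 e)).2 : ℤ) -
        (P * (-Complex.I) ^ e).re| < δ ∧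
    |δ * ((⌈(P * (-Complex.I) ^ f).im / δ⌉ • dir (Fin.ofNat 4 f + 1) +
            ⌈(P * (-Complex.I) ^ e).im / δ⌉ • dir (Fin.ofNat 4 e + 1)).1 * (dir (Fin.ofNat 4 f)).1 +
          (⌈(P * (-Complex.I) ^ f).im / δ⌉ • dir (Fin.ofNat 4 f + 1) +
            ⌈(P * (-Complex.I) ^ e).im / δ⌉ • dir (Fin.ofNat 4 e + 1)).2 * (dir (Fin.ofNat 4 f)).2 : ℤ) -
        (P * (-Complex.I) ^ f).re| < δ := by
  set F : Fin 4 := Fin.ofNat 4 f with hF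
  set E : Fin 4 := Fin.ofNat 4 e with hE
  have hEe : (E : ℕ) = e := tp_natCast_fin4 he
  set uf := P * (-Complex.I) ^ f with huf
  set ue := P * (-Complex.I) ^ e with hue
  set Yp := ⌈uf.im / δ⌉ with hYp
  set Y := ⌈ue.im / δ⌉ with hY
  set C : ℤ × ℤ := Yp • dir (F + 1) + Y • dir (E + 1) with hC
  -- ceiling bookkeeping
  have hceil : ∀ x : ℝ, 0 ≤ δ * ⌈x / δ⌉ - x ∧ δ * ⌈x / δ⌉ - x < δ := by
    intro x
    have h1 : x / δ ≤ ⌈x / δ⌉ := Int.le_ceil _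
    have h2 : (⌈x / δ⌉ : ℝ) < x / δ + 1 := Int.ceil_lt_add_one _
    rw [div_le_iff₀ hδ] at h1
    have h3 := (lt_div_iff₀ hδ).1 (by linarith : (⌈x / δ⌉ : ℝ) - 1 < x / δ)
    constructor <;> nlinarith
  -- the two cases of the turning rule
  have hcase : (m = 1 ∧ e % 4 = (f + 1) % 4) ∨ (m = 3 ∧ e % 4 = (f + 3) % 4) := by
    rcases hm with rfl | rfl
    · left; exact ⟨rfl, by omega⟩
    · right; exact ⟨rfl, by omega⟩
  -- frame coordinates of `P` in the out-frame, via the in-frame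
  have hue_conv : (m = 1 → ue.re = uf.im ∧ ue.im = -uf.re) ∧ (m = 3 → ue.re = -uf.im ∧ ue.im = uf.re) := by
    constructor
    · intro h1
      have hmod : e % 4 = (f + 1) % 4 := by omega
      have : ue = P * (-Complex.I) ^ (f + 1) := by
        rw [hue, tp_negI_pow_mod e, hmod, ← tp_negI_pow_mod]
      rw [this]; exact tp_frame_succ P f
    · intro h3
      have hmod : e % 4 = (f + 3) % 4 := by omega
      have : ue = P * (-Complex.I) ^ (f + 3) := by
        rw [hue, tp_negI_pow_mod e, hmod, ← tp_negI_pow_mod]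
      rw [this]; exact tp_frame_add_three P f
  -- coordinates of the lattice corner and of the frame displacements
  have hmeshC := tp_mesh_frame E δ C
  rw [hEe] at hmeshC
  -- distance from the mesh point of a frame displacement of `C` to `P`
  have hdistP : ∀ w : ℤ × ℤ, ∀ s t : ℤ, w = C + s • dir F + t • dir (F + 1) →
      -((J₀ : ℤ) + 2) ≤ s → s ≤ J₀ + 2 → -((J₀ : ℤ) + 2) ≤ t → t ≤ J₀ + 2 →
      |δ * (C.1 * (dir E).1 + C.2 * (dir E).2 : ℤ) - ue.re| < δ →
      |δ * (C.1 * (dir (E + 1)).1 + C.2 * (dir (E + 1)).2 : ℤ) - ue.im| < δ →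
      dist ((w.1 : ℂ) * ((δ : ℝ) : ℂ) + (w.2 : ℂ) * ((δ : ℝ) : ℂ) * Complex.I) P < rC := by
    intro w s t hw hs1 hs2 ht1 ht2 hre him
    have hsq : (((w.1 - C.1) ^ 2 + (w.2 - C.2) ^ 2 : ℤ) : ℝ) ≤ ((2 * J₀ + 4 : ℕ) : ℝ) ^ 2 := by
      have hi : (w.1 - C.1) ^ 2 + (w.2 - C.2) ^ 2 ≤ (2 * (J₀ : ℤ) + 4) ^ 2 := by
        rw [hw, (tp_dot_lin F C s t).2.2]; nlinarith
      have : (((w.1 - C.1) ^ 2 + (w.2 - C.2) ^ 2 : ℤ) : ℝ) ≤ (((2 * (J₀ : ℤ) + 4) ^ 2 : ℤ) : ℝ) := by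
        exact_mod_cast hi
      refine this.trans (le_of_eq ?_)
      push_cast; ring
    have hd := tp_mesh_dist_le hδ.le (by positivity) w C hsq
    have hCP : dist ((C.1 : ℂ) * ((δ : ℝ) : ℂ) + (C.2 : ℂ) * ((δ : ℝ) : ℂ) * Complex.I) P < 2 * δ := by
      rw [dist_eq_norm]
      have hn : ‖(C.1 : ℂ) * ((δ : ℝ) : ℂ) + (C.2 : ℂ) * ((δ : ℝ) : ℂ) * Complex.I - P‖ =
          ‖((C.1 : ℂ) * ((δ : ℝ) : ℂ) + (C.2 : ℂ) * ((δ : ℝ) : ℂ) * Complex.I - P) * (-Complex.I) ^ e‖ := by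
        rw [norm_mul, norm_pow, norm_neg, Complex.norm_I, one_pow, mul_one]
      rw [hn]
      refine lt_of_le_of_lt (Complex.norm_le_abs_re_add_abs_im _) ?_
      rw [sub_mul, Complex.sub_re, Complex.sub_im, hmeshC.1, hmeshC.2]
      linarith
    have := dist_triangle ((w.1 : ℂ) * ((δ : ℝ) : ℂ) + (w.2 : ℂ) * ((δ : ℝ) : ℂ) * Complex.I)
      ((C.1 : ℂ) * ((δ : ℝ) : ℂ) + (C.2 : ℂ) * ((δ : ℝ) : ℂ) * Complex.I) P
    push_cast at hd
    nlinarith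
  have hK31 : F + 3 + 1 = F := (tp_fin4 F).2.2.1
  have hK33 : F + 3 + 3 = F + 2 := (tp_fin4 F).2.2.2.2.2
  have h11 : (Fin.ofNat 4 1 : Fin 4) = 1 := rfl
  have h33 : (Fin.ofNat 4 3 : Fin 4) = 3 := rfl
  rcases hcase with ⟨hm1, hmod⟩ | ⟨hm3, hmod⟩
  · -- CONVEX: `E = F + 1`
    subst hm1
    have hEF : E = F + 1 := by have := tp_fin_of_mod hmod; rwa [h11] at this
    obtain ⟨hre, him⟩ := hue_conv.1 rfl
    have hdE1 : dir (E + 1) = -dir F := by rw [hEF, (tp_fin4 F).1, tp_dir_add_two]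
    have hCexp : C = 0 + (-Y) • dir F + Yp • dir (F + 1) := by rw [hC, hdE1]; module
    have hC1 : C.1 * (dir F).1 + C.2 * (dir F).2 = -Y := by
      have := (tp_dot_lin F 0 (-Y) Yp).1; rw [← hCexp] at this; simpa using this
    have hC2 : C.1 * (dir (F + 1)).1 + C.2 * (dir (F + 1)).2 = Yp := by
      have := (tp_dot_lin F 0 (-Y) Yp).2.1; rw [← hCexp] at this; simpa using this
    have hCE : C.1 * (dir E).1 + C.2 * (dir E).2 = Yp := by rw [hEF]; exact hC2
    have hCE1 : C.1 * (dir (E + 1)).1 + C.2 * (dir (E + 1)).2 = Y := by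
      rw [hdE1]; simp; linarith [hC1]
    -- the rounding facts
    have hR1 : |δ * (C.1 * (dir E).1 + C.2 * (dir E).2 : ℤ) - ue.re| < δ := by
      rw [hCE, hre]; have := hceil uf.im; rw [abs_of_nonneg this.1]; exact this.2
    have hR1' : |δ * (C.1 * (dir (E + 1)).1 + C.2 * (dir (E + 1)).2 : ℤ) - ue.im| < δ := by
      rw [hCE1]; have := hceil ue.im; rw [abs_of_nonneg this.1]; exact this.2
    have hR2 : |δ * (C.1 * (dir F).1 + C.2 * (dir F).2 : ℤ) - uf.re| < δ := by
      rw [hC1, show uf.re = -ue.im by linarith]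
      have := hceil ue.im; rw [abs_sub_comm]
      rw [show -ue.im - δ * ((-Y : ℤ) : ℝ) = δ * Y - ue.im by push_cast; ring, abs_of_nonneg this.1]
      exact this.2
    -- the lattice chart near `C`
    have hclos1 : ∀ w, dist w P < rC → (w ∈ S ↔ 0 ≤ ((w - P) * (-Complex.I) ^ (E : ℕ)).re ∧
        0 ≤ ((w - P) * (-Complex.I) ^ (E : ℕ)).im) := fun w hw => by
      rw [hEe]; exact (hclos w hw).trans tp_csec_one
    have hlat := tp_lattice_convex hδ hV E hclos1
    have hmem : ∀ s t : ℤ, -((J₀ + 2 : ℕ) : ℤ) ≤ s → s ≤ (J₀ + 2 : ℕ) → -((J₀ + 2 : ℕ) : ℤ) ≤ t →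
        t ≤ (J₀ + 2 : ℕ) → (C + s • dir (F + 3 + 1) + t • dir (F + 3) ∈ V ↔ t ≤ 0 ∧ s ≤ 0) := by
      intro s t hs1 hs2 ht1 ht2
      rw [hK31, tp_dir_add_three, smul_neg, ← neg_smul]
      set w := C + s • dir F + (-t) • dir (F + 1) with hw
      have hlin := tp_dot_lin F C s (-t)
      rw [← hw] at hlin
      have hwd := hdistP w s (-t) hw (by push_cast at hs1; omega) (by push_cast at hs2; omega)
        (by push_cast at ht2; omega) (by push_cast at ht1; omega) hR1 hR1'
      rw [hlat w hwd, hEe, hre, ← hY]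
      rw [show w.1 * (dir E).1 + w.2 * (dir E).2 = Yp - t by rw [hEF, hlin.2.1, hC2]; ring]
      rw [show w.1 * (dir (E + 1)).1 + w.2 * (dir (E + 1)).2 = Y - s by
        rw [hdE1]; simp; linarith [hlin.1, hC1]]
      rw [← hYp]
      omega
    refine ⟨⟨J₀ + 1 + J₀, ?_⟩, ?_, hR1, hR2⟩
    · have hw := tp_walk_convex V (F + 3) C (J₀ + 2) J₀ J₀ le_rfl le_rfl hmem
      rw [hK31] at hw
      rw [hw, hEF, (tp_fin4 F).2.2.2.2.1]
    · have := (tp_dot_lin F (C - (J₀ : ℤ) • dir F) J₀ J₀).2.2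
      have e1 : C - (J₀ : ℤ) • dir F + (J₀ : ℤ) • dir F + (J₀ : ℤ) • dir (F + 1) = C + (J₀ : ℤ) • dir E := by
        rw [hEF]; module
      rw [e1] at this
      rw [this]; ring
  · -- REFLEX: `E = F + 3`
    subst hm3
    have hEF : E = F + 3 := by have := tp_fin_of_mod hmod; rwa [h33] at this
    obtain ⟨hre, him⟩ := hue_conv.2 rfl
    have hdE : dir E = -dir (F + 1) := by rw [hEF, tp_dir_add_three]
    have hdE1 : dir (E + 1) = dir F := by rw [hEF, hK31]
    have hCexp : C = 0 + Y • dir F + Yp • dir (F + 1) := by rw [hC, hdE1]; module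
    have hC1 : C.1 * (dir F).1 + C.2 * (dir F).2 = Y := by
      have := (tp_dot_lin F 0 Y Yp).1; rw [← hCexp] at this; simpa using this
    have hC2 : C.1 * (dir (F + 1)).1 + C.2 * (dir (F + 1)).2 = Yp := by
      have := (tp_dot_lin F 0 Y Yp).2.1; rw [← hCexp] at this; simpa using this
    have hCE : C.1 * (dir E).1 + C.2 * (dir E).2 = -Yp := by
      rw [hdE]; simp; linarith [hC2]
    have hCE1 : C.1 * (dir (E + 1)).1 + C.2 * (dir (E + 1)).2 = Y := by rw [hdE1]; exact hC1
    -- the rounding facts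
    have hR1 : |δ * (C.1 * (dir E).1 + C.2 * (dir E).2 : ℤ) - ue.re| < δ := by
      rw [hCE, hre]
      have := hceil uf.im
      rw [show δ * ((-Yp : ℤ) : ℝ) - -uf.im = -(δ * Yp - uf.im) by push_cast; ring, abs_neg,
        abs_of_nonneg this.1]
      exact this.2
    have hR1' : |δ * (C.1 * (dir (E + 1)).1 + C.2 * (dir (E + 1)).2 : ℤ) - ue.im| < δ := by
      rw [hCE1]; have := hceil ue.im; rw [abs_of_nonneg this.1]; exact this.2
    have hR2 : |δ * (C.1 * (dir F).1 + C.2 * (dir F).2 : ℤ) - uf.re| < δ := by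
      rw [hC1, ← him]; have := hceil ue.im; rw [abs_of_nonneg this.1]; exact this.2
    -- the lattice chart near `C`
    have hclos3 : ∀ w, dist w P < rC → (w ∈ S ↔ 0 ≤ ((w - P) * (-Complex.I) ^ (E : ℕ)).im ∨
        ((w - P) * (-Complex.I) ^ (E : ℕ)).re ≤ 0) := fun w hw => by
      rw [hEe]; exact (hclos w hw).trans tp_csec_three
    have hlat := tp_lattice_reflex hδ hV E hclos3
    have hmem : ∀ s t : ℤ, -((J₀ + 2 : ℕ) : ℤ) ≤ s → s ≤ (J₀ + 2 : ℕ) → -((J₀ + 2 : ℕ) : ℤ) ≤ t →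
        t ≤ (J₀ + 2 : ℕ) → (C + s • dir (F + 3 + 1) + t • dir (F + 3) ∈ V ↔ t ≤ 0 ∨ 0 ≤ s) := by
      intro s t hs1 hs2 ht1 ht2
      rw [hK31, tp_dir_add_three, smul_neg, ← neg_smul]
      set w := C + s • dir F + (-t) • dir (F + 1) with hw
      have hlin := tp_dot_lin F C s (-t)
      rw [← hw] at hlin
      have hwd := hdistP w s (-t) hw (by push_cast at hs1; omega) (by push_cast at hs2; omega)
        (by push_cast at ht2; omega) (by push_cast at ht1; omega) hR1 hR1'
      rw [hlat w hwd, hEe, hre, neg_div, Int.floor_neg, ← hY, ← hYp]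
      rw [show w.1 * (dir (E + 1)).1 + w.2 * (dir (E + 1)).2 = Y + s by rw [hdE1, hlin.1, hC1]]
      rw [show w.1 * (dir E).1 + w.2 * (dir E).2 = -(Yp - t) by
        rw [hdE]; simp; linarith [hlin.2.1, hC2]]
      omega
    refine ⟨⟨(J₀ - 1) + 1 + (J₀ - 1), ?_⟩, ?_, hR1, hR2⟩
    · have hw := tp_walk_reflex V (F + 3) C (J₀ + 2) J₀ J₀ hJ₀ hJ₀ le_rfl le_rfl hmem
      rw [hK31, hK33, (tp_fin4 F).2.1] at hw
      rw [hw, hEF, (tp_fin4 F).2.2.2.2.2]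
    · have := (tp_dot_lin F (C - (J₀ : ℤ) • dir F) J₀ (-(J₀ : ℤ))).2.2
      have e1 : C - (J₀ : ℤ) • dir F + (J₀ : ℤ) • dir F + (-(J₀ : ℤ)) • dir (F + 1) =
          C + (J₀ : ℤ) • dir E := by
        rw [hdE]; module
      rw [e1] at this
      rw [this]; ring

/-- **Registered sub-goal `s7_frameAddThree` of stub `stub_transportPaths`** (three quarter turns
of the frame, one-line form of `tp_frame_add_three`; the corner-jump theorem `tp_corner_jump` of
this file exceeds the registration cap). [folklore] -/
theorem s7_frameAddThree : ∀ (u : ℂ) (f : ℕ), (u * (-Complex.I) ^ (f + 3)).re = -(u * (-Complex.I) ^ f).im ∧ (u * (-Complex.I) ^ (f + 3)).im = (u * (-Complex.I) ^ f).re :=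
  fun u f => tp_frame_add_three u f

end Summit.CriticalPhenomena.CardyFormulaZ2.Cruxes.BoundaryDefectGaussianR.RainbowMonomialsInExcursionKernels

end
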